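import Mathlib
import Summits.CriticalPhenomena.PercolationContinuityZ3.Theses.PercNearOneGluing
import Summits.CriticalPhenomena.PercolationContinuityZ3.Theorems.PercNearOneGluingNoHeavyLowerTailTouchLemma
import Summits.CriticalPhenomena.PercolationContinuityZ3.Theorems.PercNearOneGluingNoHeavyLowerTailResidualOfNearOneGluing
import Summits.CriticalPhenomena.PercolationContinuityZ3.Theorems.PercNearOneGluingNoHeavyLowerTailReduction
import HarnessLib

/-!
# Crux `PercNearOneGluing.NoHeavyLowerTail` (stmt-CriticalPhenomena-4575), strategy (c):
# Conjecture 3 ⇔ its TOUCHING form (the ε–δ reductions)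

Helper file for the crux (`--supports stmt-CriticalPhenomena-4575`), route `PercNearOneGluing`,
task `nh-c-bk-reimer`; sequel of `…TouchLemma.lean` (`bad_le_touch`:
`(1 - δ) μ(Bad) ≤ μ(Bad ∩ Touch)` with `Bad = {o ↔ A} ∩ {o ↮ b}`,
`Touch = {∃ x y, w{x,y} ≠ 0, o ↔ x, y ↔ b}`, `δ ≥ max_{a ∈ A} μ(a ↮ b)`).

* `nearOneGluing_of_touchGluing` — Kozma–Nitzan Conjecture 3 (`NearOneGluing`, arXiv:2401.12397
  p. 15) from its touching form
  `TouchGluing : ∀ ε ∃ δ ∀ n w A o b, 1-δ < μ(o↔A) → (∀ a ∈ A, 1-δ < μ(a↔b)) → μ(Bad ∩ Touch) < ε`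
  (`μ(o ↮ b) ≤ μ(o ↮ A) + μ(Bad) ≤ δ + μ(Bad ∩ Touch)/(1-δ)`);
* `touchGluing_of_nearOneGluing` — the converse (`Bad ∩ Touch ⊆ {o ↮ b}`), so the two are
  EQUIVALENT: the typed residual of strategy (c) is the crux in a sharper coordinate (a designated
  closed positive-weight pair between the two clusters), recorded as such;
* `noHeavyLowerTail_of_touchGluing` — the crux from the touching form, through the landed
  reductions `manyFingersLargePocket_of_nearOneGluing` (p81702) and
  `noHeavyLowerTail_of_manyFingersLargePocket` (p76496).
-/

namespace Summit.CriticalPhenomena.PercolationContinuityZ3.Theorems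

open MeasureTheory Set
open Literature.Probability.LatticeModels Literature.Probability.Percolation
open Summit.CriticalPhenomena.PercolationContinuityZ3.Theses.PercNearOneGluing

/-- **Conjecture 3 from its touching form.** If for every `ε > 0` there is `δ > 0` such that
`μ(o ↔ A) > 1 - δ` and `μ(a ↔ b) > 1 - δ` (`a ∈ A`) imply
`μ({o ↔ A} ∩ {o ↮ b} ∩ Touch) < ε`, then `NearOneGluing` (Kozma–Nitzan Conjecture 3) holds:
`μ(o ↮ b) ≤ μ(o ↮ A) + μ(Bad) ≤ δ + μ(Bad ∩ Touch)/(1 - δ)`. [folklore] -/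
theorem nearOneGluing_of_touchGluing
    (hT : ∀ ε : ℝ, 0 < ε → ∃ δ : ℝ, 0 < δ ∧ ∀ (n : ℕ) (w : Sym2 (Fin n) → unitInterval)
      (A : Finset (Fin n)) (o b : Fin n),
      1 - δ < (prodBernoulli w).real (⋃ a ∈ A, openConn o a) →
      (∀ a ∈ A, 1 - δ < (prodBernoulli w).real (openConn a b)) →
      (prodBernoulli w).real ((⋃ a ∈ A, openConn o a) ∩ (openConn o b)ᶜ ∩
        {ω : Set (Sym2 (Fin n)) | ∃ x y : Fin n, w s(x, y) ≠ 0 ∧ ω ∈ openConn o x ∧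
          ω ∈ openConn y b}) < ε) :
    NearOneGluing := by
  intro ε hε
  obtain ⟨δ₀, hδ₀, hδ₀P⟩ := hT (ε / 4) (by positivity)
  refine ⟨min δ₀ (min (ε / 4) (1 / 2)), by positivity, ?_⟩
  intro n w A o b hoA hab
  set δ := min δ₀ (min (ε / 4) (1 / 2)) with hδdef
  have hδ₁ : δ ≤ δ₀ := min_le_left _ _
  have hδ₂ : δ ≤ ε / 4 := (min_le_right _ _).trans (min_le_left _ _)
  have hδ₃ : δ ≤ 1 / 2 := (min_le_right _ _).trans (min_le_right _ _)
  set μ := prodBernoulli w with hμ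
  set U : Set (Set (Sym2 (Fin n))) := ⋃ a ∈ A, openConn o a with hU
  set Bad : Set (Set (Sym2 (Fin n))) := U ∩ (openConn o b)ᶜ with hBad
  set T : Set (Set (Sym2 (Fin n))) := {ω | ∃ x y : Fin n, w s(x, y) ≠ 0 ∧ ω ∈ openConn o x ∧
    ω ∈ openConn y b} with hTdef
  -- the touching form at `ε/4`, level `δ₀ ≥ δ`
  have hBT : μ.real (Bad ∩ T) < ε / 4 :=
    hδ₀P n w A o b (lt_of_le_of_lt (by linarith) hoA)
      (fun a ha => lt_of_le_of_lt (by linarith) (hab a ha))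
  -- the complement bounds `μ(a ↮ b) ≤ δ`
  have hA' : ∀ a ∈ A, μ.real (openConn a b)ᶜ ≤ δ := by
    intro a ha
    have h1 : μ.real (openConn a b)ᶜ = 1 - μ.real (openConn a b) := by
      rw [measureReal_compl (touch_measurableSet_config _), probReal_univ]
    rw [h1]; linarith [hab a ha]
  have hBad_le : (1 - δ) * μ.real Bad ≤ μ.real (Bad ∩ T) := bad_le_touch w A o b hA'
  have hBad : μ.real Bad ≤ ε / 2 := by nlinarith [hBad_le, hBT, hδ₃, measureReal_nonneg (μ := μ) (s := Bad)]
  -- `{o ↮ b} ⊆ {o ↮ A} ∪ Bad`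
  have hcover : (openConn o b)ᶜ ⊆ Uᶜ ∪ Bad := by
    intro ω hω
    by_cases hωU : ω ∈ U
    · exact Or.inr ⟨hωU, hω⟩
    · exact Or.inl hωU
  have hUc : μ.real Uᶜ < δ := by
    rw [measureReal_compl (touch_measurableSet_config _), probReal_univ]; linarith
  have hob : μ.real (openConn o b)ᶜ < ε := by
    calc μ.real (openConn o b)ᶜ ≤ μ.real (Uᶜ ∪ Bad) := measureReal_mono hcover
      _ ≤ μ.real Uᶜ + μ.real Bad := measureReal_union_le _ _
      _ < δ + ε / 2 := by linarith
      _ ≤ ε := by linarith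
  have : μ.real (openConn o b)ᶜ = 1 - μ.real (openConn o b) := by
    rw [measureReal_compl (touch_measurableSet_config _), probReal_univ]
  linarith

/-- **The touching form from Conjecture 3** (trivial direction: `Bad ∩ Touch ⊆ {o ↮ b}`), so the
two are EQUIVALENT. [folklore] -/
theorem touchGluing_of_nearOneGluing (hX : NearOneGluing) :
    ∀ ε : ℝ, 0 < ε → ∃ δ : ℝ, 0 < δ ∧ ∀ (n : ℕ) (w : Sym2 (Fin n) → unitInterval)
      (A : Finset (Fin n)) (o b : Fin n),
      1 - δ < (prodBernoulli w).real (⋃ a ∈ A, openConn o a) →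
      (∀ a ∈ A, 1 - δ < (prodBernoulli w).real (openConn a b)) →
      (prodBernoulli w).real ((⋃ a ∈ A, openConn o a) ∩ (openConn o b)ᶜ ∩
        {ω : Set (Sym2 (Fin n)) | ∃ x y : Fin n, w s(x, y) ≠ 0 ∧ ω ∈ openConn o x ∧
          ω ∈ openConn y b}) < ε := by
  intro ε hε
  obtain ⟨δ, hδ, h⟩ := hX ε hε
  refine ⟨δ, hδ, fun n w A o b hoA hab => ?_⟩
  have hob := h n w A o b hoA hab
  have hc : (prodBernoulli w).real (openConn o b)ᶜ = 1 - (prodBernoulli w).real (openConn o b) := by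
    rw [measureReal_compl (touch_measurableSet_config _), probReal_univ]
  calc (prodBernoulli w).real _ ≤ (prodBernoulli w).real (openConn o b)ᶜ :=
        measureReal_mono fun ω hω => hω.1.2
    _ < ε := by rw [hc]; linarith

/-- **Registered sub-goal `touchLemma` (the structural lemma, signature verbatim):** for every
weighted graph on `Fin n`, relay set `A`, observer `o`, target `b` and `δ ≥ μ(a ↮ b)` (`a ∈ A`),
`(1 - δ) · μ({o ↔ A} ∩ {o ↮ b}) ≤ μ({o ↔ A} ∩ {o ↮ b} ∩ Touch)` — `bad_le_touch` of the companion
file with explicit binders. [folklore] -/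
theorem touchLemma : ∀ (n : ℕ) (w : Sym2 (Fin n) → unitInterval) (A : Finset (Fin n)) (o b : Fin n) (δ : ℝ), (∀ a ∈ A, (Literature.Probability.LatticeModels.prodBernoulli w).real (Literature.Probability.Percolation.openConn a b)ᶜ ≤ δ) → (1 - δ) * (Literature.Probability.LatticeModels.prodBernoulli w).real ((⋃ a ∈ A, Literature.Probability.Percolation.openConn o a) ∩ (Literature.Probability.Percolation.openConn o b)ᶜ) ≤ (Literature.Probability.LatticeModels.prodBernoulli w).real ((⋃ a ∈ A, Literature.Probability.Percolation.openConn o a) ∩ (Literature.Probability.Percolation.openConn o b)ᶜ ∩ {ω : Set (Sym2 (Fin n)) | ∃ x y : Fin n, w s(x, y) ≠ 0 ∧ ω ∈ Literature.Probability.Percolation.openConn o x ∧ ω ∈ Literature.Probability.Percolation.openConn y b}) :=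
  fun _n w A o b _δ hA => bad_le_touch w A o b hA

/-- **Registered sub-goal `noHeavyLowerTail_of_touchGluing` (signature verbatim): the crux from
its touching form**, through `nearOneGluing_of_touchGluing` and the landed reductions
`manyFingersLargePocket_of_nearOneGluing` (p81702) and
`noHeavyLowerTail_of_manyFingersLargePocket` (p76496). [folklore] -/
theorem noHeavyLowerTail_of_touchGluing : (∀ ε : ℝ, 0 < ε → ∃ δ : ℝ, 0 < δ ∧ ∀ (n : ℕ) (w : Sym2 (Fin n) → unitInterval) (A : Finset (Fin n)) (o b : Fin n), 1 - δ < (Literature.Probability.LatticeModels.prodBernoulli w).real (⋃ a ∈ A, Literature.Probability.Percolation.openConn o a) → (∀ a ∈ A, 1 - δ < (Literature.Probability.LatticeModels.prodBernoulli w).real (Literature.Probability.Percolation.openConn a b)) → (Literature.Probability.LatticeModels.prodBernoulli w).real ((⋃ a ∈ A, Literature.Probability.Percolation.openConn o a) ∩ (Literature.Probability.Percolation.openConn o b)ᶜ ∩ {ω : Set (Sym2 (Fin n)) | ∃ x y : Fin n, w s(x, y) ≠ 0 ∧ ω ∈ Literature.Probability.Percolation.openConn o x ∧ ω ∈ Literature.Probability.Percolation.openConn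 y b}) < ε) → Summit.CriticalPhenomena.PercolationContinuityZ3.Theses.PercNearOneGluing.NoHeavyLowerTail :=
  fun hT => noHeavyLowerTail_of_manyFingersLargePocket
    (manyFingersLargePocket_of_nearOneGluing (nearOneGluing_of_touchGluing hT))

end Summit.CriticalPhenomena.PercolationContinuityZ3.Theorems
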